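import Summits.ResolutionOfSingularities.ResolutionOfSingularities.Theorems.MarkedTransferCampaignW46WWalkTerminates
import Summits.ResolutionOfSingularities.ResolutionOfSingularities.Theorems.MarkedTransferCampaignW46MohWindowShadeFormalNRChart
import Literature.AlgebraicGeometry.Resolution.DerivativeIdealsSupport
import Mathlib.FieldTheory.PrimitiveElement
import HarnessLib

/-!
# [OURS · L1 W4.6 rung (iii-2), NON-RATIONAL W-WALK, brick 5] THE ROOT `w`-ANCHOR AT AN ARBITRARY CLOSED SINGULAR POINT: Cohen
# coordinates over the residue field of the point (finite over the perfect ground field: primitive element, Hensel, recognition)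

Cell `res-hironaka`, LADDER-RESOLUTION rung L (D-0089), slot W4.6 rung (iii); seat res-L1-s46-pv-6 (gen 8). Host route MarkedTransfer,
`--supports stmt-ResolutionOfSingularities-16155 --as helper`; kind proof (no definition). res-L1-s46-pv-5's `…WWalkTerminates.exists_wAnchor_start`
builds the root anchor of the W-walk over an ALGEBRAICALLY CLOSED ground field (rational singular points, constants from `K`). Over a PERFECT
ground field `K` a closed singular point `ξ` has residue field `κ(ξ)` finite separable over `K`; this file builds Cohen coordinates
`𝒪̂_{Z,ξ} ≅ L⟦t,y,z⟧` over `L = K(θ) ≅ κ(ξ)` (`θ` a primitive element, `π₀` its minimal polynomial) adapted to o1's `(x, y, z)`: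
* `finite_residueField_stalk` — `κ(ξ)` is finite over `K` at a closed point of an ambient datum (Zariski's lemma on an affine chart, localization
  preserves the residue field);
* `exists_coeffField_stalk` — a COEFFICIENT FIELD of the completion: a perfect field `L` of characteristic `p` and `ι : L → 𝒪̂_ξ` mapping ONTO
  the residue field (primitive element theorem; Hensel lift of `θ` by this seat's gen-7 `exists_root_of_irreducible`; `exists_coeffField`);
* `exists_cohen_coords` — `E : 𝒪̂_ξ ≅ L⟦t,y,z⟧` with `E(x) = t`, `E(y) = y`, `E(z) = z` for any generators `(x,y,z)` of `𝔪_ξ` (pv-2's recognition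
  `FormalChart.exists_ringEquiv_mvPowerSeries_of_generators`);
* `exists_wAnchor_start_nr` — THE ROOT `w`-ANCHOR of o1's regime `regimeMohWindowSurfaceInsep` at any closed singular point: `E(f₀) = z^p + f`,
  `f = Σ E(a_i) t^{d−i} y^i` of order `≥ d ≥ p + 1`.

HONEST FRAMING. OURS; nothing here is a statement of H. Hironaka's manuscript [Hironaka2017] and nothing of it is used. AI-written;
AI review is weaker than expert review. No `sorry`; axioms standard. [cite: StacksProject, Tag 00FZ] (Zariski's lemma / Nullstellensatz);
[cite: StacksProject, Tag 030N] (primitive element); [cite: Matsumura1987, Thm. 8.3] (Hensel), Thm. 28.3 (coefficient fields), Thm. 29.7 (Cohen);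
[folklore].
-/

noncomputable section

set_option linter.dupNamespace false -- mandated namespace of this single-conjunct summit

open MvPowerSeries IsLocalRing Finset
open Literature.AlgebraicGeometry.Resolution
open Literature.RingTheory.MvPowerSeries.Jets (mem_maximalIdeal_iff_constantCoeff_eq_zero mem_maximalIdeal_pow_iff)

namespace Summit.ResolutionOfSingularities.ResolutionOfSingularities.Theorems

namespace CampaignW46

namespace WWalkNR

open CategoryTheory AlgebraicGeometry TopologicalSpace
open Literature.AlgebraicGeometry.Hironaka2017.S02Preliminaries
open Literature.AlgebraicGeometry.Hironaka2017.Datum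
open Scheme.IdealSheafData
open WWalk
open MohWindowShadeFormalNR (exists_root_of_irreducible exists_coeffField eval_sub_eval_mem)

variable {p : ℕ} [hp : Fact p.Prime] {K : Type} [Field K] [CharP K p]

/-! ## §1 The residue field at a closed point is finite over the ground field -/

/-- **The residue field of the stalk at a closed point of an ambient datum is finite over `K`** (for the `K`-structure
`stalkAlgebra (overHom K Z) ξ`): on an affine open `U ∋ ξ` the prime of `ξ` is maximal, `Γ(Z, U) → 𝒪_{Z,ξ}/𝔪` is surjective (localization
preserves the residue field at a maximal ideal), so `κ(ξ)` is a field of finite type over `K`, hence finite (Zariski's lemma). Same proof as the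
tree's `finite_residue_stalk_overHom` (route FrobeniusClosing). [cite: StacksProject, Tag 00FZ] -/
theorem finite_residueField_stalk (A : AmbientDatum p K) (ξ : A.Z) (hξ : IsClosed ({ξ} : Set A.Z)) :
    letI : A.Z.Over (Spec (.of K)) := ⟨A.hom⟩
    letI := stalkAlgebra (overHom K A.Z) ξ
    Module.Finite K (ResidueField (A.Z.presheaf.stalk ξ)) := by
  letI : A.Z.Over (Spec (.of K)) := ⟨A.hom⟩
  haveI := A.smooth
  haveI : LocallyOfFiniteType (A.Z ↘ Spec (.of K)) := by
    change LocallyOfFiniteType A.hom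
    infer_instance
  obtain ⟨U, hU, hξU, -⟩ := exists_isAffineOpen_mem_and_subset (X := A.Z) (x := ξ) (U := ⊤) (Opens.mem_top ξ)
  letI := sectionsAlgebra (overHom K A.Z) U
  letI := stalkAlgebra (overHom K A.Z) ξ
  letI algx : Algebra Γ(A.Z, U) (A.Z.presheaf.stalk ξ) := (A.Z.presheaf.germ U ξ hξU).hom.toAlgebra
  haveI : IsScalarTower K Γ(A.Z, U) (A.Z.presheaf.stalk ξ) :=
    IsScalarTower.of_algebraMap_eq fun c => (RingHom.congr_fun (germ_comp_sectionsHom (overHom K A.Z) U ξ hξU) c).symm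
  haveI : IsLocalization.AtPrime (A.Z.presheaf.stalk ξ) (hU.primeIdealOf ⟨ξ, hξU⟩).asIdeal := hU.isLocalization_stalk ⟨ξ, hξU⟩
  haveI : (hU.primeIdealOf ⟨ξ, hξU⟩).asIdeal.IsMaximal := hU.primeIdealOf_isMaximal_of_isClosed ⟨ξ, hξU⟩ hξ
  haveI : Algebra.FiniteType K Γ(A.Z, U) := finiteType_sectionsHom_overHom K A.Z ⟨U, hU⟩
  have hsurj : Function.Surjective (algebraMap Γ(A.Z, U) (ResidueField (A.Z.presheaf.stalk ξ))) := by
    intro y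
    obtain ⟨z, hz⟩ := (IsLocalization.AtPrime.equivQuotMaximalIdeal (hU.primeIdealOf ⟨ξ, hξU⟩).asIdeal (A.Z.presheaf.stalk ξ)).surjective y
    obtain ⟨a, rfl⟩ := Ideal.Quotient.mk_surjective z
    exact ⟨a, hz⟩
  haveI : Algebra.FiniteType K (ResidueField (A.Z.presheaf.stalk ξ)) :=
    Algebra.FiniteType.of_surjective (IsScalarTower.toAlgHom K Γ(A.Z, U) (ResidueField (A.Z.presheaf.stalk ξ))) hsurj
  exact finite_of_finite_type_of_isJacobsonRing K (ResidueField (A.Z.presheaf.stalk ξ))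

/-! ## §2 A coefficient field of the completion -/

/-- **A COEFFICIENT FIELD of `𝒪̂_{Z,ξ}` at a closed point over a perfect ground field**: a perfect field `L` of characteristic `p` and a ring map
`ι : L → 𝒪̂_ξ` mapping onto the residue field. (`κ(ξ) = K(θ)` by the primitive element theorem, `π₀` the minimal polynomial of `θ`; a lift of
`θ` to the stalk is refined to a root of `π₀` in the completion by Hensel; `L = K[X]/(π₀)`.) [cite: StacksProject, Tag 030N]
[cite: Matsumura1987, Thm. 28.3] -/
theorem exists_coeffField_stalk [PerfectField K] (A : AmbientDatum p K) (ξ : A.Z) (hξ : IsClosed ({ξ} : Set A.Z))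
    [IsRegularLocalRing (A.Z.presheaf.stalk ξ)] :
    ∃ (L : Type) (_ : Field L) (_ : CharP L p) (_ : PerfectField L)
      (ι : L →+* AdicCompletion (maximalIdeal (A.Z.presheaf.stalk ξ)) (A.Z.presheaf.stalk ξ)),
      ∀ c, ∃ l : L, c - ι l ∈ maximalIdeal (AdicCompletion (maximalIdeal (A.Z.presheaf.stalk ξ)) (A.Z.presheaf.stalk ξ)) := by
  classical
  letI : A.Z.Over (Spec (.of K)) := ⟨A.hom⟩
  set R := A.Z.presheaf.stalk ξ with hR
  letI := stalkAlgebra (overHom K A.Z) ξ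
  haveI : Module.Finite K (ResidueField R) := finite_residueField_stalk A ξ hξ
  haveI : Algebra.IsAlgebraic K (ResidueField R) := Algebra.IsAlgebraic.of_finite K _
  haveI : Algebra.IsSeparable K (ResidueField R) := Algebra.IsAlgebraic.isSeparable_of_perfectField
  set C := AdicCompletion (maximalIdeal R) R with hC
  set ofR := algebraMap R C with hofR
  haveI : IsNoetherianRing C := isNoetherianRing_adicCompletion_maximalIdeal R
  have h𝔪C : maximalIdeal C = (maximalIdeal R).map ofR := AdicCompletion.maximalIdeal_eq_map
  -- a primitive element `θ` of `κ(ξ)/K`, its minimal polynomial, a lift `r₀ ∈ R`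
  obtain ⟨θ, hθ⟩ := Field.exists_primitive_element K (ResidueField R)
  have hθint : IsIntegral K θ := Algebra.IsIntegral.isIntegral θ
  set π₀ := minpoly K θ with hπ₀
  have hirr : Irreducible π₀ := minpoly.irreducible hθint
  have hm : π₀.Monic := minpoly.monic hθint
  haveI : Fact (Irreducible π₀) := ⟨hirr⟩
  obtain ⟨r₀, hr₀⟩ := residue_surjective θ
  set κK : K →+* R := algebraMap K R with hκK
  set ιC : K →+* C := ofR.comp κK with hιC
  have halg : ∀ l : K, algebraMap K (ResidueField R) l = residue R (κK l) := fun l =>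
    (IsScalarTower.algebraMap_apply K R (ResidueField R) l)
  -- every element of `κ(ξ)` is a `K`-polynomial in `θ`
  have hpoly : ∀ x : ResidueField R, ∃ P : Polynomial K, x = Polynomial.aeval θ P := by
    intro x
    have hx : x ∈ (IntermediateField.adjoin K {θ}).toSubalgebra := by rw [hθ]; trivial
    rw [IntermediateField.adjoin_simple_toSubalgebra_of_isAlgebraic (Algebra.IsAlgebraic.isAlgebraic θ),
      Algebra.adjoin_singleton_eq_range_aeval] at hx
    obtain ⟨P, hP⟩ := hx
    exact ⟨P, hP.symm⟩
  have hcompκ : (residue R).comp κK = algebraMap K (ResidueField R) := RingHom.ext fun l => (halg l).symm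
  have haeval : ∀ P : Polynomial K, residue R ((P.map κK).eval r₀) = Polynomial.aeval θ P := by
    intro P
    rw [Polynomial.eval_map, Polynomial.hom_eval₂, hr₀, hcompκ, Polynomial.aeval_def]
  -- residues in `C` are `K`-polynomials in `ofR r₀`
  have hres : ∀ c : C, ∃ P : Polynomial K, c - (P.map ιC).eval (ofR r₀) ∈ maximalIdeal C := by
    intro c
    obtain ⟨ybar, hybar⟩ := (AdicCompletion.residueField_map_bijective R).2 (residue _ c)
    obtain ⟨y, rfl⟩ := residue_surjective ybar
    obtain ⟨P, hP⟩ := hpoly (residue R y)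
    refine ⟨P, ?_⟩
    have h1 : c - ofR y ∈ maximalIdeal C := by
      rw [ResidueField.map_residue] at hybar
      rw [← Ideal.Quotient.eq]
      exact hybar.symm
    have h2 : y - (P.map κK).eval r₀ ∈ maximalIdeal R := by
      rw [← Ideal.Quotient.eq]
      change residue R y = residue R ((P.map κK).eval r₀)
      rw [haeval, hP]
    have h3 : ofR y - (P.map ιC).eval (ofR r₀) ∈ maximalIdeal C := by
      rw [hιC, ← Polynomial.map_map, Polynomial.eval_map, Polynomial.eval₂_hom, ← map_sub, h𝔪C]
      exact Ideal.mem_map_of_mem _ h2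
    have := Ideal.add_mem _ h1 h3
    rwa [sub_add_sub_cancel] at this
  -- Hensel: a root `a` of `π₀` near `ofR r₀`
  have hπr₀ : (π₀.map ιC).eval (ofR r₀) ∈ maximalIdeal C := by
    have h2 : (π₀.map κK).eval r₀ ∈ maximalIdeal R := by
      rw [← Ideal.Quotient.eq_zero_iff_mem]
      change residue R ((π₀.map κK).eval r₀) = 0
      rw [haeval, hπ₀, minpoly.aeval]
    rw [hιC, ← Polynomial.map_map, Polynomial.eval_map, Polynomial.eval₂_hom, h𝔪C]
    exact Ideal.mem_map_of_mem _ h2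
  obtain ⟨-, a, ha, haa₀⟩ := exists_root_of_irreducible ιC hirr hm (ofR r₀) hπr₀
  obtain ⟨ι', -, -, -, hsurj⟩ := exists_coeffField ιC π₀ a (ofR r₀) ha haa₀ hres
  haveI : Module.Finite K (AdjoinRoot π₀) := (AdjoinRoot.powerBasis hirr.ne_zero).finite
  haveI : PerfectField (AdjoinRoot π₀) := Algebra.IsAlgebraic.perfectField K
  haveI : CharP (AdjoinRoot π₀) p := charP_of_injective_ringHom (AdjoinRoot.of π₀).injective p
  exact ⟨AdjoinRoot π₀, inferInstance, inferInstance, inferInstance, ι', hsurj⟩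

/-! ## §3 Cohen coordinates adapted to three generators -/

/-- **Cohen coordinates adapted to `(x, y, z)`, over a coefficient field of the point.** `𝒪_{Z,ξ}` regular of embedding dimension `3` at a closed
point, `(x, y, z)` generating `𝔪`: there is a perfect field `L` of characteristic `p` and `E : 𝒪̂_ξ ≅ L⟦t,y,z⟧` with `E(x) = t`, `E(y) = y`,
`E(z) = z` (indexing `t = X (some 0)`, `y = X (some 1)`, `z = X none`). [cite: Matsumura1987, Thm. 29.7] -/
theorem exists_cohen_coords [PerfectField K] (A : AmbientDatum p K) (ξ : A.Z) (hξ : IsClosed ({ξ} : Set A.Z))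
    [IsRegularLocalRing (A.Z.presheaf.stalk ξ)] (h3 : (maximalIdeal (A.Z.presheaf.stalk ξ)).spanFinrank = 3)
    {x y z : A.Z.presheaf.stalk ξ} (hxyz : Ideal.span {x, y, z} = maximalIdeal (A.Z.presheaf.stalk ξ)) :
    ∃ (L : Type) (_ : Field L) (_ : CharP L p) (_ : PerfectField L)
      (E : AdicCompletion (maximalIdeal (A.Z.presheaf.stalk ξ)) (A.Z.presheaf.stalk ξ) ≃+* MvPowerSeries (Option (Fin 2)) L),
      E (algebraMap _ _ x) = X (some 0) ∧ E (algebraMap _ _ y) = X (some 1) ∧ E (algebraMap _ _ z) = X none := by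
  classical
  set C := AdicCompletion (maximalIdeal (A.Z.presheaf.stalk ξ)) (A.Z.presheaf.stalk ξ)
  set ofR := algebraMap (A.Z.presheaf.stalk ξ) C with hofR
  haveI : IsNoetherianRing C := isNoetherianRing_adicCompletion_maximalIdeal (A.Z.presheaf.stalk ξ)
  have h𝔪C : maximalIdeal C = (maximalIdeal (A.Z.presheaf.stalk ξ)).map ofR := AdicCompletion.maximalIdeal_eq_map
  obtain ⟨L, _i1, _i2, _i3, ι, hι⟩ := exists_coeffField_stalk A ξ hξ
  set v : Option (Fin 2) → A.Z.presheaf.stalk ξ := fun o => o.elim z (fun l => (![x, y] : Fin 2 → A.Z.presheaf.stalk ξ) l) with hv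
  have hgen : Ideal.span (Set.range fun o : Option (Fin 2) => ofR (v o)) = maximalIdeal C := by
    rw [h𝔪C, show Ideal.map ofR (maximalIdeal (A.Z.presheaf.stalk ξ)) = Ideal.map ofR (Ideal.span {x, y, z}) by rw [hxyz], Ideal.map_span]
    congr 1
    ext c
    simp only [Set.mem_range, Set.mem_image, Set.mem_insert_iff, Set.mem_singleton_iff]
    constructor
    · rintro ⟨o, rfl⟩
      rcases o with _ | l
      · exact ⟨z, Or.inr (Or.inr rfl), rfl⟩
      · have hl : l = 0 ∨ l = 1 := by fin_cases l <;> simp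
        rcases hl with rfl | rfl
        · exact ⟨x, Or.inl rfl, rfl⟩
        · exact ⟨y, Or.inr (Or.inl rfl), rfl⟩
    · rintro ⟨r, hr, rfl⟩
      rcases hr with rfl | rfl | rfl
      · exact ⟨some 0, rfl⟩
      · exact ⟨some 1, rfl⟩
      · exact ⟨none, rfl⟩
  have hdim : ringKrullDim C = Fintype.card (Option (Fin 2)) := by
    rw [ringKrullDim_adicCompletion]
    have h := IsRegularLocalRing.spanFinrank_maximalIdeal (R := A.Z.presheaf.stalk ξ)
    rw [h3] at h
    simp only [Fintype.card_option, Fintype.card_fin]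
    exact_mod_cast h.symm
  obtain ⟨E, hEX, -⟩ := FormalChart.exists_ringEquiv_mvPowerSeries_of_generators ι hι _ hgen hdim
  exact ⟨L, _i1, _i2, _i3, E, hEX (some 0), hEX (some 1), hEX none⟩

/-! ## §4 The root `w`-anchor of o1's regime at an arbitrary closed singular point -/

/-- **THE ROOT `w`-ANCHOR OVER A PERFECT GROUND FIELD.** At a singular point of a state of o1's regime `regimeMohWindowSurfaceInsep` (a closed
point, possibly NOT residually rational), Cohen coordinates over a coefficient field `L` of the point adapted to the regime's own `(x, y, z)`
turn the generator `z^p + Σ a_i x^{d−i} y^i` into `z^p + f` with `ord f ≥ d ≥ p + 1` — no cleaning needed at the root (pv-5's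
`exists_wAnchor_start` without algebraic closure). [OURS · L1 W4.6 rung (iii)] NOT a statement of the manuscript. [cite: Matsumura1987, Thm. 29.7] -/
theorem exists_wAnchor_start_nr [PerfectField K] {A : AmbientDatum p K} {E : IdealExponent A.Z}
    (hRg : regimeMohWindowSurfaceInsep (p := p) (K := K) A E) {ξ : A.Z} (hξ : ξ ∈ E.sing) :
    ∃ (L : Type) (_ : Field L) (_ : CharP L p) (_ : PerfectField L)
      (e : AdicCompletion (maximalIdeal (A.Z.presheaf.stalk ξ)) (A.Z.presheaf.stalk ξ) ≃+* MvPowerSeries (Option (Fin 2)) L)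
      (f₀ : A.Z.presheaf.stalk ξ) (w f : MvPowerSeries (Option (Fin 2)) L),
      stalkIdeal E.J ξ = Ideal.span {f₀} ∧ IsUnit w ∧ e (algebraMap _ _ f₀) = w * (X none ^ p + f) ∧ LowVanish (p + 1) f := by
  classical
  obtain ⟨hR, h3, hcl, -, -⟩ := MohWindowShadeAnchorWalk.regime_point hRg hξ
  haveI := hR
  obtain ⟨-, -, x, y, z, hxyz, d, a, hbd, -, -, hI⟩ := coeffAt_of_regime hRg hξ
  obtain ⟨L, _i1, _i2, _i3, e, hEx, hEy, hEz⟩ := exists_cohen_coords A ξ hcl h3 hxyz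
  set φ : A.Z.presheaf.stalk ξ →+* MvPowerSeries (Option (Fin 2)) L :=
    (e : _ →+* MvPowerSeries (Option (Fin 2)) L).comp (algebraMap _ (AdicCompletion (maximalIdeal (A.Z.presheaf.stalk ξ)) (A.Z.presheaf.stalk ξ))) with hφ
  have hφa : ∀ r, φ r = e (algebraMap _ _ r) := fun r => rfl
  set f : MvPowerSeries (Option (Fin 2)) L := ∑ i ∈ range (d + 1), φ (a i) * X (some 0) ^ (d - i) * X (some 1) ^ i with hf
  refine ⟨L, _i1, _i2, _i3, e, z ^ p + ∑ i ∈ range (d + 1), a i * x ^ (d - i) * y ^ i, 1, f, hI, isUnit_one, ?_, ?_⟩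
  · rw [one_mul, ← hφa, map_add, map_pow, hφa z, hEz, map_sum]
    congr 1
    refine sum_congr rfl fun i _ => ?_
    rw [map_mul, map_mul, map_pow, map_pow, hφa x, hEx, hφa y, hEy]
  · refine mem_maximalIdeal_pow_iff.mp (Ideal.pow_le_pow_right (by omega : p + 1 ≤ d) (Ideal.sum_mem _ fun i hi => ?_))
    rw [mem_range] at hi
    rw [mul_assoc]
    refine Ideal.mul_mem_left _ _ ?_
    have h1 := Ideal.mul_mem_mul
      (Ideal.pow_mem_pow (mem_maximalIdeal_iff_constantCoeff_eq_zero.mpr (constantCoeff_X (some 0) : constantCoeff (X (some 0) : MvPowerSeries (Option (Fin 2)) L) = 0)) (d - i))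
      (Ideal.pow_mem_pow (mem_maximalIdeal_iff_constantCoeff_eq_zero.mpr (constantCoeff_X (some 1) : constantCoeff (X (some 1) : MvPowerSeries (Option (Fin 2)) L) = 0)) i)
    rwa [← pow_add, show d - i + i = d by omega] at h1

end WWalkNR

end CampaignW46

end Summit.ResolutionOfSingularities.ResolutionOfSingularities.Theorems

end
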